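import Summits.ValiantsHypothesis.ValiantsHypothesis.Theorems.DepthWindowTreeBiasMono

/-!
# Route `DepthWindow` — low-bias trees as a MASS-AGGREGATION GAME: star, padding, substitution

Cone-free helper (decomp-valiant lens 4, g15) supporting the crux item `HomImmHardTwoOne`
(stmt-ValiantsHypothesis-30635).  `LowBiasTree w Δ β` (`DepthWindowNodeBias`: a depth-`Δ` levelled tree all
of whose node biases are `≤ β`) is the object every universal BUILDER for the conjecture `ULB_C` must produce.
This file turns tree building into word-level recursion, so that builders never touch label functions:

* `lowBiasTree_one_of_sum_abs_le` — the STAR: if `Σ |wᵢ| ≤ β` the depth-`1` tree qualifies;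
* `LowBiasTree.depth_mono` — PADDING: a low-bias tree of depth `Δ` is one of every depth `Δ' ≥ Δ` as soon as
  `|Σ w| ≤ β` (unary nodes above the root have node bias `|Σ w|`);
* `lowBiasTree_succ_of_quotient` — SUBSTITUTION (one round of the mass-aggregation game): if the letters are
  grouped by `c : Fin d → Fin M` (onto) into groups of `ℓ¹`-mass `Σ_{c i = m} |wᵢ| ≤ β`, and the QUOTIENT word
  `w' m = Σ_{c i = m} wᵢ` has a low-bias tree of depth `Δ`, then `w` has one of depth `Δ + 1` (hang the groups
  under the leaves of the quotient tree).

Consequently `LowBiasTree w Δ β` holds whenever the multiset `{wᵢ}` can be reduced to a single number in `Δ`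
rounds, each round replacing groups of mass `≤ β` by their sums — the form in which the two-letter builder of
`DepthWindowTwoLetterULB` is written.

References: [LimayeSrinivasanTavenas2022] CCC 2022 (LIPIcs 234:32) Def. 2; full version ECCC TR22-090 Def. 15,
Prop. 16–17.
-/

-- layout Summits/ValiantsHypothesis/ValiantsHypothesis forces the duplicated namespace component
set_option linter.dupNamespace false

namespace Summit.ValiantsHypothesis.ValiantsHypothesis.Theorems.DepthWindow.TreeBias

open Finset

variable {d : ℕ}

/-! ### Level `0` bookkeeping -/

/-- The node bias of a level-`1` node is the `ℓ¹`-mass of its block. [cite: LimayeSrinivasanTavenas2022, Def. 15] -/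
theorem nodeBias_one (w : Fin d → ℤ) (T : LTree d) (i : Fin d) :
    nodeBias w T 1 i = ∑ j ∈ univ.filter (fun j => T.lab 1 j = T.lab 1 i), |w j| := by
  unfold nodeBias
  rw [show (1 : ℕ) - 1 = 0 from rfl]
  rw [show (T.lab 0) = id from funext T.leaf, image_id]
  exact sum_congr rfl fun l _ => by rw [blockSum_zero]

/-! ### The star -/

/-- The **star** on `Fin d`: level `0` the leaves, every higher level a single block. [folklore] -/
def starTree (d : ℕ) : LTree d where
  lab t i := if t = 0 then i else ⟨0, i.pos⟩
  leaf i := by simp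
  refine t i j _ := by simp

/-- **Depth one.**  If `Σ |wᵢ| ≤ β` the star is a `LowBiasTree w 1 β` (its only internal node, the root, has node
bias `‖w‖₁`). [cite: LimayeSrinivasanTavenas2022, Def. 15] -/
theorem lowBiasTree_one_of_sum_abs_le {w : Fin d → ℤ} {β : ℤ} (hw : ∑ i, |w i| ≤ β) : LowBiasTree w 1 β := by
  refine ⟨starTree d, fun i j => by simp [starTree], fun u hu1 hu i => ?_⟩
  obtain rfl : u = 1 := le_antisymm hu hu1
  rw [nodeBias_one]
  exact le_trans (sum_le_sum_of_subset_of_nonneg (filter_subset _ _) fun j _ _ => abs_nonneg _) hw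

/-! ### Padding -/

/-- Node biases of the padded tree below the freezing level are those of the tree. [folklore] -/
theorem nodeBias_pad_of_le (w : Fin d → ℤ) (T : LTree d) {Δ u : ℕ} (hu : u ≤ Δ) (i : Fin d) :
    nodeBias w (T.pad Δ) u i = nodeBias w T u i := by
  unfold nodeBias
  rw [T.pad_lab_of_le hu, T.pad_lab_of_le (by omega : u - 1 ≤ Δ)]
  exact sum_congr rfl fun l _ => by rw [blockSum_pad_of_le w T (by omega : u - 1 ≤ Δ)]

/-- Above a single-block level `Δ` the padded tree is unary: its node bias there is `|Σ w|`. [folklore] -/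
theorem nodeBias_pad_of_gt (w : Fin d → ℤ) (T : LTree d) {Δ u : ℕ} (hroot : ∀ i j, T.lab Δ i = T.lab Δ j)
    (hu : Δ < u) (i : Fin d) : nodeBias w (T.pad Δ) u i = |∑ j, w j| := by
  unfold nodeBias
  rw [T.pad_lab_of_ge hu.le, T.pad_lab_of_ge (by omega : Δ ≤ u - 1)]
  rw [filter_true_of_mem (fun j _ => hroot j i)]
  have himg : (univ : Finset (Fin d)).image (T.lab Δ) = {T.lab Δ i} := by
    ext l
    simp only [mem_image, mem_univ, true_and, mem_singleton]
    exact ⟨fun ⟨j, hj⟩ => hj ▸ hroot j i, fun hl => ⟨i, hl.symm⟩⟩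
  rw [himg, sum_singleton]
  unfold blockSum
  rw [T.pad_lab_of_ge (by omega : Δ ≤ u - 1), filter_true_of_mem (fun j _ => hroot j i)]

/-- **Padding.**  A low-bias tree of depth `Δ` is one of every depth `Δ' ≥ Δ`, provided `|Σ w| ≤ β` (the node
bias of the unary nodes above the old root). [cite: LimayeSrinivasanTavenas2022, Def. 2] -/
theorem LowBiasTree.depth_mono {w : Fin d → ℤ} {Δ Δ' : ℕ} {β : ℤ} (hT : LowBiasTree w Δ β) (hle : Δ ≤ Δ')
    (hsum : |∑ j, w j| ≤ β) : LowBiasTree w Δ' β := by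
  obtain ⟨T, hroot, hnb⟩ := hT
  refine ⟨T.pad Δ, fun i j => ?_, fun u hu1 hu i => ?_⟩
  · rw [T.pad_lab_of_ge hle]; exact hroot i j
  · rcases le_or_gt u Δ with huΔ | huΔ
    · rw [nodeBias_pad_of_le w T huΔ]; exact hnb u hu1 huΔ i
    · rw [nodeBias_pad_of_gt w T hroot huΔ]; exact hsum

/-- Depth one and more: if `Σ |wᵢ| ≤ β` then `w` has a low-bias tree of every depth `Δ ≥ 1`. [folklore] -/
theorem lowBiasTree_of_sum_abs_le {w : Fin d → ℤ} {β : ℤ} (hw : ∑ i, |w i| ≤ β) {Δ : ℕ} (hΔ : 1 ≤ Δ) :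
    LowBiasTree w Δ β :=
  (lowBiasTree_one_of_sum_abs_le hw).depth_mono hΔ (le_trans (abs_sum_le_sum_abs _ _) hw)

/-! ### Substitution: one round of the mass-aggregation game -/

/-- The **quotient word** of `w` under the grouping `c`: letter `m` is the sum of the group `c⁻¹ m`. [folklore] -/
def quotWord (w : Fin d → ℤ) {M : ℕ} (c : Fin d → Fin M) (m : Fin M) : ℤ :=
  ∑ i ∈ univ.filter (fun i => c i = m), w i

/-- The quotient word has the same total. [folklore] -/
theorem sum_quotWord (w : Fin d → ℤ) {M : ℕ} (c : Fin d → Fin M) : ∑ m, quotWord w c m = ∑ i, w i :=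
  sum_fiberwise_of_maps_to (fun i _ => mem_univ (c i)) w

section substitute

variable {M : ℕ} (c : Fin d → Fin M) (hc : Function.Surjective c)

/-- A section of the (onto) grouping map. [folklore] -/
noncomputable def grpRep (m : Fin M) : Fin d := Classical.choose (hc m)

/-- The section is a right inverse of the grouping map. [folklore] -/
theorem c_grpRep (m : Fin M) : c (grpRep c hc m) = m := Classical.choose_spec (hc m)

/-- The section is injective. [folklore] -/
theorem grpRep_injective : Function.Injective (grpRep c hc) := fun m m' h => by
  rw [← c_grpRep c hc m, ← c_grpRep c hc m', h]

/-- **Substituted tree**: level `0` the leaves of `w`; level `t + 1` is level `t` of the quotient tree `T'`,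
pulled back along the grouping `c` (labels made letters of `w` again through a section of `c`). [folklore] -/
noncomputable def LTree.substitute (T' : LTree M) : LTree d where
  lab t i := if t = 0 then i else grpRep c hc (T'.lab (t - 1) (c i))
  leaf i := by simp
  refine t i j h := by
    rcases Nat.eq_zero_or_pos t with rfl | ht
    · simp only [if_true] at h
      subst h; rfl
    · simp only [Nat.pos_iff_ne_zero.1 ht, if_false] at h
      have h' := T'.refine (t - 1) (c i) (c j) (grpRep_injective c hc h)
      rw [show t - 1 + 1 = t by omega] at h'
      simp [h']

/-- Labels of the substituted tree above level `0`. [folklore] -/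
theorem substitute_lab_succ (T' : LTree M) (t : ℕ) (i : Fin d) :
    (LTree.substitute c hc T').lab (t + 1) i = grpRep c hc (T'.lab t (c i)) := by
  simp [LTree.substitute]

/-- Level-`(t+1)` blocks of the substituted tree are unions of groups: their sums are the level-`t` block
sums of the quotient word. [folklore] -/
theorem blockSum_substitute_succ (w : Fin d → ℤ) (T' : LTree M) (t : ℕ) (l : Fin M) :
    blockSum w (LTree.substitute c hc T') (t + 1) (grpRep c hc l) = blockSum (quotWord w c) T' t l := by
  unfold blockSum quotWord
  have hfilter : (univ.filter fun j => (LTree.substitute c hc T').lab (t + 1) j = grpRep c hc l) =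
      univ.filter fun j => T'.lab t (c j) = l := by
    ext j
    simp only [mem_filter, mem_univ, true_and, substitute_lab_succ]
    exact (grpRep_injective c hc).eq_iff
  rw [hfilter]
  rw [← sum_fiberwise_of_maps_to (s := univ.filter fun j => T'.lab t (c j) = l)
    (t := univ.filter fun m => T'.lab t m = l) (g := c) (fun j hj => by simpa using hj) w]
  refine sum_congr rfl fun m hm => sum_congr ?_ fun _ _ => rfl
  ext j
  simp only [mem_filter, mem_univ, true_and]
  constructor
  · rintro ⟨-, rfl⟩; trivial
  · rintro rfl; exact ⟨by simpa using hm, rfl⟩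

/-- Node biases of the substituted tree: at level `1` the group masses, at level `v + 1 ≥ 2` the node biases of
the quotient tree at level `v`. [cite: LimayeSrinivasanTavenas2022, Def. 15] -/
theorem nodeBias_substitute_one (w : Fin d → ℤ) (T' : LTree M) (i : Fin d) :
    nodeBias w (LTree.substitute c hc T') 1 i = ∑ j ∈ univ.filter (fun j => c j = c i), |w j| := by
  rw [nodeBias_one]
  refine sum_congr ?_ fun _ _ => rfl
  ext j
  simp only [mem_filter, mem_univ, true_and, substitute_lab_succ, T'.leaf]
  exact (grpRep_injective c hc).eq_iff

/-- Node biases of the substituted tree at level `v + 1 ≥ 2` are those of the quotient tree at level `v`.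
[cite: LimayeSrinivasanTavenas2022, Def. 15] -/
theorem nodeBias_substitute_succ (w : Fin d → ℤ) (T' : LTree M) {v : ℕ} (hv : 1 ≤ v) (i : Fin d) :
    nodeBias w (LTree.substitute c hc T') (v + 1) i = nodeBias (quotWord w c) T' v (c i) := by
  unfold nodeBias
  rw [show v + 1 - 1 = v from rfl]
  obtain ⟨v', rfl⟩ : ∃ v', v = v' + 1 := ⟨v - 1, by omega⟩
  rw [show v' + 1 - 1 = v' from rfl]
  have hset : (univ.filter fun j => (LTree.substitute c hc T').lab (v' + 1 + 1) j =
        (LTree.substitute c hc T').lab (v' + 1 + 1) i).image ((LTree.substitute c hc T').lab (v' + 1)) =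
      ((univ.filter fun m => T'.lab (v' + 1) m = T'.lab (v' + 1) (c i)).image (T'.lab v')).image
        (grpRep c hc) := by
    ext l
    simp only [mem_image, mem_filter, mem_univ, true_and, substitute_lab_succ]
    constructor
    · rintro ⟨j, hj, rfl⟩
      exact ⟨T'.lab v' (c j), ⟨c j, grpRep_injective c hc hj, rfl⟩, rfl⟩
    · rintro ⟨l', ⟨m, hm, rfl⟩, rfl⟩
      obtain ⟨j, rfl⟩ := hc m
      exact ⟨j, by rw [hm], rfl⟩
  rw [hset, sum_image fun x _ y _ hxy => grpRep_injective c hc hxy]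
  exact sum_congr rfl fun l' _ => by rw [blockSum_substitute_succ]

/-- **Substitution (one round of the mass-aggregation game).**  Group the letters of `w` by an onto map
`c : Fin d → Fin M` into groups of `ℓ¹`-mass `≤ β`; if the quotient word (group sums) has a low-bias tree of depth
`Δ` and node bias `≤ β`, then `w` has one of depth `Δ + 1`. [cite: LimayeSrinivasanTavenas2022, Def. 15, Prop. 16] -/
theorem lowBiasTree_succ_of_quotient (hc : Function.Surjective c) {w : Fin d → ℤ} {β : ℤ}
    (hmass : ∀ m, ∑ j ∈ univ.filter (fun j => c j = m), |w j| ≤ β) {Δ : ℕ}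
    (hT' : LowBiasTree (quotWord w c) Δ β) : LowBiasTree w (Δ + 1) β := by
  obtain ⟨T', hroot, hnb⟩ := hT'
  refine ⟨LTree.substitute c hc T', fun i j => ?_, fun u hu1 hu i => ?_⟩
  · rw [substitute_lab_succ, substitute_lab_succ, hroot (c i) (c j)]
  · obtain ⟨v, rfl⟩ : ∃ v, u = v + 1 := ⟨u - 1, by omega⟩
    rcases Nat.eq_zero_or_pos v with rfl | hv
    · rw [nodeBias_substitute_one]; exact hmass (c i)
    · rw [nodeBias_substitute_succ c hc w T' hv]
      exact hnb v hv (by omega) (c i)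

end substitute

end Summit.ValiantsHypothesis.ValiantsHypothesis.Theorems.DepthWindow.TreeBias
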